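import Summits.KontsevichZagierPeriods.KontsevichZagierPeriods.Theorems.FermatIsogenyDeepWordSectorBP2

/-! # `FermatIsogenyDeepWordSectorBP3` — part 3/7 of the mechanical ≤400-line split of `B_src.lean` (sha256 9cb321caf3c881c0…)
Source: decomp-kz lens-5 g22 DeepWordSectorB.lean v4 @d2f1e37a (levels 3/4 closed hypothesis-free, Dirichlet move proved, level 6 from the linear rung; critic CLEARED g7-5 l.1397 / g7-7 l.1406); --supports stmt-KontsevichZagierPeriods-3898.
Split by census-1 g10 `gen/splitlean.py`: scopes re-opened with their `open`/`variable`/`set_option` context; mathematics and declaration order unchanged. -/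

noncomputable section
namespace Summit.KontsevichZagierPeriods.FermatIsogeny.DeepTargets
open Literature.NumberTheory.Transcendental MeasureTheory
open Summit.KontsevichZagierPeriods.KontsevichZagierPeriods.Theses.FermatIsogeny (BetaLinearSector BetaProductSector FermatSectorComplete)

/-- Rational numbers are real algebraic. [bookkeeping] -/
private theorem isAlgebraic_ratCast (x : ℚ) : IsAlgebraic ℚ (x : ℝ) := by
  have h := isAlgebraic_algebraMap (R := ℚ) (A := ℝ) x
  rwa [eq_ratCast] at h

/-- Auxiliary step `isAlgebraic_two`: is Algebraic two. [bookkeeping] -/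
private theorem isAlgebraic_two : IsAlgebraic ℚ (2:ℝ) := by
  simpa using isAlgebraic_ratCast 2

namespace BetaMoves
open MeasureTheory Set
open Literature.NumberTheory.Transcendental Literature.NumberTheory.Transcendental.KZ
open Literature.ModelTheory.ExponentialFields (IsSemialgebraic)
open Summit.KontsevichZagierPeriods.HermiteRigidity.CMTwistQuasiPeriodTransfer
  (isSemialgebraic_setOf_apply_lt_of_isAlgebraic isSemialgebraic_setOf_apply_gt_of_isAlgebraic
    of_sub_of_sub_mem_relations_split of_sub_of_mem_changeOfVariablesRel_dimOne)

open Literature.NumberTheory.Transcendental MeasureTheory in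
open Summit.KontsevichZagierPeriods.KontsevichZagierPeriods.Theses.FermatIsogeny (BetaLinearSector BetaProductSector FermatSectorComplete) in
open MeasureTheory Set in
open Literature.NumberTheory.Transcendental Literature.NumberTheory.Transcendental.KZ in
open Literature.ModelTheory.ExponentialFields (IsSemialgebraic) in
open Summit.KontsevichZagierPeriods.HermiteRigidity.CMTwistQuasiPeriodTransfer (isSemialgebraic_setOf_apply_lt_of_isAlgebraic isSemialgebraic_setOf_apply_gt_of_isAlgebraic of_sub_of_sub_mem_relations_split of_sub_of_mem_changeOfVariablesRel_dimOne) in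
/-- `1 - 4x(1-x) = (1-2x)²`. -/
private theorem betaDup_one_sub (x : ℝ) : 1 - 4 * x * (1 - x) = (1 - 2 * x) ^ 2 := by ring

open Literature.NumberTheory.Transcendental MeasureTheory in
open Summit.KontsevichZagierPeriods.KontsevichZagierPeriods.Theses.FermatIsogeny (BetaLinearSector BetaProductSector FermatSectorComplete) in
open MeasureTheory Set in
open Literature.NumberTheory.Transcendental Literature.NumberTheory.Transcendental.KZ in
open Literature.ModelTheory.ExponentialFields (IsSemialgebraic) in
open Summit.KontsevichZagierPeriods.HermiteRigidity.CMTwistQuasiPeriodTransfer (isSemialgebraic_setOf_apply_lt_of_isAlgebraic isSemialgebraic_setOf_apply_gt_of_isAlgebraic of_sub_of_sub_mem_relations_split of_sub_of_mem_changeOfVariablesRel_dimOne) in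
/-- `Φ = 4x(1-x)` is injective on `{x < 1/2}`: `Φ p = Φ q` forces `(p-q)(1-p-q) = 0`. -/
private theorem betaDup_inj {p q : ℝ} (hp : p < 1 / 2) (hq : q < 1 / 2)
    (h : 4 * p * (1 - p) = 4 * q * (1 - q)) : p = q := by
  have h1 : (p - q) * (4 * (1 - p - q)) = 0 := by linear_combination h
  rcases mul_eq_zero.1 h1 with h2 | h2
  · linarith
  · linarith

open Literature.NumberTheory.Transcendental MeasureTheory in
open Summit.KontsevichZagierPeriods.KontsevichZagierPeriods.Theses.FermatIsogeny (BetaLinearSector BetaProductSector FermatSectorComplete) in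
open MeasureTheory Set in
open Literature.NumberTheory.Transcendental Literature.NumberTheory.Transcendental.KZ in
open Literature.ModelTheory.ExponentialFields (IsSemialgebraic) in
open Summit.KontsevichZagierPeriods.HermiteRigidity.CMTwistQuasiPeriodTransfer (isSemialgebraic_setOf_apply_lt_of_isAlgebraic isSemialgebraic_setOf_apply_gt_of_isAlgebraic of_sub_of_sub_mem_relations_split of_sub_of_mem_changeOfVariablesRel_dimOne) in
/-- The derivative of `Φ(x) = 4x(1-x)` is `4(1-2x)`. -/
private theorem betaDup_hasDerivAt (x : ℝ) :
    HasDerivAt (fun x : ℝ => 4 * x * (1 - x)) (4 * (1 - 2 * x)) x := by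
  have h1 : HasDerivAt (fun x : ℝ => 4 * x) 4 x := by
    simpa using (hasDerivAt_id x).const_mul (4:ℝ)
  have h2 : HasDerivAt (fun x : ℝ => 1 - x) (-1) x := by
    simpa using (hasDerivAt_id x).const_sub (1:ℝ)
  exact (h1.mul h2).congr_deriv (by ring)

/-- File-local copy of `BetaMoves.betaSymm_fold` (private in the landed …BP2; dedup twin of the tree's `stub_betaSymm_fold`). [bookkeeping] -/
private theorem betaSymm_fold : ∀ a : ℚ, 0 < a → ∀ (r h : KZ.IntegralRep 1),
    r.domain = {x | x 0 ∈ Set.Ioo (0:ℝ) 1} →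
    Set.EqOn r.integrand (fun x => (x 0) ^ ((a:ℝ) - 1) * (1 - x 0) ^ ((a:ℝ) - 1)) r.domain →
    h.domain = {x | 0 < x 0 ∧ x 0 < 1 / 2} →
    Set.EqOn h.integrand (fun x => 2 * ((x 0) ^ ((a:ℝ) - 1) * (1 - x 0) ^ ((a:ℝ) - 1))) h.domain →
    KZ.Equivalent r h := by
  intro a _ r h hrd hri hhd hhi
  have hhalf : IsAlgebraic ℚ ((1:ℝ) / 2) := by
    simpa using isAlgebraic_algebraMap (R := ℚ) (A := ℝ) (1 / 2 : ℚ)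
  -- the two halves of `r`
  have hs₁ : IsSemialgebraic ℚ (r.domain ∩ {p : Fin 1 → ℝ | p 0 < 1 / 2}) :=
    r.isSemialgebraic_domain.inter (isSemialgebraic_setOf_apply_lt_of_isAlgebraic hhalf 0)
  have hs₂ : IsSemialgebraic ℚ (r.domain ∩ {p : Fin 1 → ℝ | 1 / 2 < p 0}) :=
    r.isSemialgebraic_domain.inter (isSemialgebraic_setOf_apply_gt_of_isAlgebraic hhalf 0)
  set W₁ := r.restrict _ hs₁ inter_subset_left with hW₁
  set W₂ := r.restrict _ hs₂ inter_subset_left with hW₂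
  -- rule (1a): split at `1/2`
  have hsplit : of r - of W₁ - of W₂ ∈ relations :=
    of_sub_of_sub_mem_relations_split r W₁ W₂ hhalf rfl rfl (fun _ _ => rfl) (fun _ _ => rfl)
  have hW₁d : W₁.domain = {x : Fin 1 → ℝ | 0 < x 0 ∧ x 0 < 1 / 2} := by
    rw [hW₁, IntegralRep.domain_restrict, hrd]
    ext x
    simp only [mem_inter_iff, mem_setOf_eq, mem_Ioo]
    constructor
    · rintro ⟨⟨h1, -⟩, h2⟩; exact ⟨h1, h2⟩
    · rintro ⟨h1, h2⟩; exact ⟨⟨h1, by linarith⟩, h2⟩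
  have hW₂d : W₂.domain = {x : Fin 1 → ℝ | 1 / 2 < x 0 ∧ x 0 < 1} := by
    rw [hW₂, IntegralRep.domain_restrict, hrd]
    ext x
    simp only [mem_inter_iff, mem_setOf_eq, mem_Ioo]
    constructor
    · rintro ⟨⟨-, h1⟩, h2⟩; exact ⟨h2, h1⟩
    · rintro ⟨h1, h2⟩; exact ⟨⟨by linarith, h2⟩, h1⟩
  -- rule (2): the reflection `x ↦ 1 - x` identifies the lower half with the upper half
  have hrefl : of W₁ - of W₂ ∈ relations := by
    refine of_sub_of_mem_relations_of_boxReflection (0 : Fin 1) ?_ fun x hx => ?_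
    · rw [hW₁d, hW₂d]
      ext x
      simp only [mem_setOf_eq, mem_preimage, boxReflection_apply_self]
      constructor <;> rintro ⟨h1, h2⟩ <;> constructor <;> linarith
    · have hx' : 0 < x 0 ∧ x 0 < 1 / 2 := by rw [hW₁d] at hx; exact hx
      have hmem : x ∈ r.domain := by rw [hrd]; exact ⟨hx'.1, by linarith [hx'.2]⟩
      have hmem' : boxReflection (0 : Fin 1) x ∈ r.domain := by
        rw [hrd]
        show boxReflection 0 x 0 ∈ Ioo (0:ℝ) 1
        rw [boxReflection_apply_self]
        exact ⟨by linarith [hx'.2], by linarith [hx'.1]⟩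
      rw [hW₁, hW₂, IntegralRep.integrand_restrict, IntegralRep.integrand_restrict, hri hmem,
        hri hmem']
      simp only [boxReflection_apply_self, sub_sub_cancel]
      ring
  -- rule (1b): `2·f = f + f` on `(0,1/2)`
  have hadd : of h - of W₁ - of W₁ ∈ relations := by
    refine integrandAddRel_subset_relations ⟨1, h, W₁, W₁, by rw [hW₁d, hhd], by rw [hW₁d, hhd],
      fun x hx => ?_, rfl⟩
    have hx' : 0 < x 0 ∧ x 0 < 1 / 2 := by rw [hhd] at hx; exact hx
    have hmem : x ∈ r.domain := by rw [hrd]; exact ⟨hx'.1, by linarith [hx'.2]⟩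
    rw [hhi hx, Pi.add_apply, hW₁, IntegralRep.integrand_restrict, hri hmem]
    dsimp only
    ring
  have : of r - of h = (of r - of W₁ - of W₂) - (of h - of W₁ - of W₁) - (of W₁ - of W₂) := by
    abel
  show of r - of h ∈ relations
  rw [this]
  exact relations.sub_mem (relations.sub_mem hsplit hadd) hrefl

/-- `Φ` maps `(0, 1/2)` into `(0, 1)` (`1 - Φ(x) = (1-2x)² > 0`). -/
private theorem betaDup_mem_Ioo {x : ℝ} (h0 : 0 < x) (h1 : x < 1 / 2) :
    4 * x * (1 - x) ∈ Ioo (0:ℝ) 1 := by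
  have h1x : 0 < 1 - x := by linarith
  have h2x : 0 < 1 - 2 * x := by linarith
  refine ⟨by positivity, ?_⟩
  rw [← sub_pos, betaDup_one_sub]
  positivity

/-- `Φ` maps `(0, 1/2)` ONTO `(0, 1)`: `u ∈ (0,1)` is `Φ((1 - √(1-u))/2)`. -/
private theorem betaDup_image :
    (fun x : ℝ => 4 * x * (1 - x)) '' {x : ℝ | 0 < x ∧ x < 1 / 2} = Ioo 0 1 := by
  apply Subset.antisymm
  · rintro _ ⟨x, hx, rfl⟩
    exact betaDup_mem_Ioo hx.1 hx.2
  · intro u hu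
    have hu1 : 0 < 1 - u := by linarith [hu.2]
    have hs0 : 0 < Real.sqrt (1 - u) := Real.sqrt_pos.2 hu1
    have hs1 : Real.sqrt (1 - u) < 1 := by
      rw [Real.sqrt_lt' one_pos]
      linarith [hu.1]
    have hsq : Real.sqrt (1 - u) ^ 2 = 1 - u := Real.sq_sqrt hu1.le
    refine ⟨(1 - Real.sqrt (1 - u)) / 2, ⟨by linarith, by linarith⟩, ?_⟩
    show 4 * ((1 - Real.sqrt (1 - u)) / 2) * (1 - (1 - Real.sqrt (1 - u)) / 2) = u
    linear_combination (-1:ℝ) * hsq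

/-! ## The pull-back identity -/

/-- The constant bookkeeping of the duplication formula: `2^{1-2a} · 4^{a-1} = 1/2`. -/
private theorem betaDup_const (a : ℝ) : (2:ℝ) ^ (1 - 2 * a) * (4:ℝ) ^ (a - 1) = 1 / 2 := by
  rw [show (4:ℝ) = (2:ℝ) ^ (2:ℝ) by rw [Real.rpow_two]; norm_num, ← Real.rpow_mul zero_le_two,
    ← Real.rpow_add two_pos, show (1 - 2 * a + 2 * (a - 1) : ℝ) = -1 by ring, Real.rpow_neg_one]
  norm_num

/-- The pull-back identity of step 2: for `0 < x < 1/2` and `u = 4x(1-x)`,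
`2^{1-2a} · (u^{a-1} (1-u)^{-1/2}) · |4(1-2x)| = 2 · (x^{a-1} (1-x)^{a-1})`. -/
private theorem betaDup_pullback {a x : ℝ} (hx0 : 0 < x) (hx1 : x < 1 / 2) :
    (2:ℝ) ^ (1 - 2 * a) * ((4 * x * (1 - x)) ^ (a - 1) * (1 - 4 * x * (1 - x)) ^ (-(1:ℝ) / 2)) *
        |4 * (1 - 2 * x)| = 2 * (x ^ (a - 1) * (1 - x) ^ (a - 1)) := by
  have h1x : 0 < 1 - x := by linarith
  have h2x : 0 < 1 - 2 * x := by linarith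
  have hA : (4 * x * (1 - x)) ^ (a - 1) = (4:ℝ) ^ (a - 1) * x ^ (a - 1) * (1 - x) ^ (a - 1) := by
    rw [Real.mul_rpow (by positivity) h1x.le, Real.mul_rpow (by norm_num) hx0.le]
  have hB : (1 - 4 * x * (1 - x)) ^ (-(1:ℝ) / 2) = (1 - 2 * x)⁻¹ := by
    rw [betaDup_one_sub, show ((1 - 2 * x) ^ 2 : ℝ) = (1 - 2 * x) ^ (2:ℝ) by norm_cast,
      ← Real.rpow_mul h2x.le, show (2 * (-(1:ℝ) / 2) : ℝ) = -1 by norm_num, Real.rpow_neg_one]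
  have hinv : (1 - 2 * x)⁻¹ * (4 * (1 - 2 * x)) = 4 := by
    field_simp
  have hc := betaDup_const a
  rw [hA, hB, abs_of_pos (by positivity : (0:ℝ) < 4 * (1 - 2 * x))]
  calc (2:ℝ) ^ (1 - 2 * a) * ((4:ℝ) ^ (a - 1) * x ^ (a - 1) * (1 - x) ^ (a - 1) * (1 - 2 * x)⁻¹) *
        (4 * (1 - 2 * x))
      = ((2:ℝ) ^ (1 - 2 * a) * (4:ℝ) ^ (a - 1)) * (x ^ (a - 1) * (1 - x) ^ (a - 1)) *
          ((1 - 2 * x)⁻¹ * (4 * (1 - 2 * x))) := by ring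
    _ = 2 * (x ^ (a - 1) * (1 - x) ^ (a - 1)) := by
        rw [hc, hinv]
        ring

/-! ## Step 2 of the duplication chain -/

/-- **Legendre duplication, step 2, as ONE change of variables.**
`[(0,1/2), 2·x^{a-1}(1-x)^{a-1}] ∼ [(0,1), 2^{1-2a}·u^{a-1}(1-u)^{-1/2}]` by rule (2) of the
Kontsevich–Zagier calculus along `u = 4x(1-x)`: `ℚ`-polynomial, injective on `(0,1/2)` with image
`(0,1)`, derivative `4(1-2x)`, and the pull-back identity `betaDup_pullback`.
(cite KontsevichZagier2001, §1.2 rule (2)) -/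
private theorem betaFold_duplication : ∀ a : ℚ, 0 < a → ∀ (h d : KZ.IntegralRep 1),
    h.domain = {x | 0 < x 0 ∧ x 0 < 1 / 2} →
    Set.EqOn h.integrand (fun x => 2 * ((x 0) ^ ((a:ℝ) - 1) * (1 - x 0) ^ ((a:ℝ) - 1))) h.domain →
    d.domain = {x | x 0 ∈ Set.Ioo (0:ℝ) 1} →
    Set.EqOn d.integrand
      (fun x => (2:ℝ) ^ (1 - 2 * (a:ℝ)) * ((x 0) ^ ((a:ℝ) - 1) * (1 - x 0) ^ (-(1:ℝ) / 2)))
      d.domain →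
    KZ.Equivalent h d := by
  intro a _ h d hhd hhi hdd hdi
  set φ : ℝ → ℝ := fun x => 4 * x * (1 - x) with hφ
  set φ' : ℝ → ℝ := fun x => 4 * (1 - 2 * x) with hφ'
  refine changeOfVariablesRel_subset_relations
    (of_sub_of_mem_changeOfVariablesRel_dimOne h d φ φ' ?_ (fun p _ => betaDup_hasDerivAt (p 0))
      ?_ ?_ ?_)
  · -- `Φ` is a `ℚ`-polynomial, hence `ℚ`-semialgebraic on the domain
    exact (isSemialgebraicFunOn_aeval h.isSemialgebraic_domain
      (MvPolynomial.C 4 * MvPolynomial.X 0 * (1 - MvPolynomial.X 0) : MvPolynomial (Fin 1) ℚ)).congr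
      (fun x _ => by simp [hφ])
  · -- injectivity on `(0, 1/2)`
    intro p hp q hq hpq
    rw [hhd] at hp hq
    exact betaDup_inj hp.2 hq.2 hpq
  · -- the image is `(0, 1)`
    rw [hdd, hhd]
    ext y
    simp only [mem_setOf_eq, mem_image]
    constructor
    · intro hy
      have : y 0 ∈ φ '' {x : ℝ | 0 < x ∧ x < 1 / 2} := by rw [betaDup_image]; exact hy
      obtain ⟨w, hw, hwy⟩ := this
      exact ⟨fun _ => w, hw, funext fun i => by rw [Subsingleton.elim i 0]; exact hwy⟩
    · rintro ⟨p, hp, rfl⟩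
      exact betaDup_mem_Ioo hp.1 hp.2
  · -- the pull-back identity on the domain
    intro p hp
    have hp' : 0 < p 0 ∧ p 0 < 1 / 2 := by rw [hhd] at hp; exact hp
    have hφp : (fun _ : Fin 1 => φ (p 0)) ∈ d.domain := by
      rw [hdd]
      exact betaDup_mem_Ioo hp'.1 hp'.2
    rw [hhi hp, hdi hφp]
    exact (betaDup_pullback hp'.1 hp'.2).symm

end BetaMoves

section Legendre

/-- The Legendre constant `2^{1−2a}`. [bookkeeping] -/
noncomputable def dupConst (a : ℚ) : ℝ := (2:ℝ) ^ (1 - 2 * (a:ℝ))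

/-- Auxiliary step `isAlgebraic_dupConst`: is Algebraic dup Const. [bookkeeping] -/
theorem isAlgebraic_dupConst (a : ℚ) : IsAlgebraic ℚ (dupConst a) := by
  have h := KZ.isAlgebraic_natCast_rpow_ratCast 2 (1 - 2 * a)
  rw [dupConst]
  convert h using 2 <;> push_cast <;> ring

/-- Auxiliary step `dupConst_pos`: dup Const pos. [bookkeeping] -/
theorem dupConst_pos (a : ℚ) : 0 < dupConst a := Real.rpow_pos_of_pos two_pos _

/-- **LEGENDRE'S DUPLICATION IN `P`**: `β(a,a) = κ(2^{1−2a}) · β(a,½)` for every rational `a > 0` — fold at `½`, then the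
substitution `u = 4x(1−x)` (two KZ moves, `BetaMoves.betaSymm_fold`, `BetaMoves.betaFold_duplication`).
(cite AndrewsAskeyRoy1999, Thm 1.5.1) -/
theorem bcl_dup (a : ℚ) (ha : 0 < a) :
    bcl a a = kc (dupConst a) (isAlgebraic_dupConst a) * bcl a (1/2) := by
  have hhalf : IsAlgebraic ℚ ((1:ℝ) / 2) := by
    simpa using isAlgebraic_algebraMap (R := ℚ) (A := ℝ) (1 / 2 : ℚ)
  have hb : (0:ℚ) < 1/2 := by norm_num
  have hrd : (bRep a a ha ha).domain = {x | x 0 ∈ Set.Ioo (0:ℝ) 1} := bRep_domain a a ha ha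
  have hri := bRep_integrand a a ha ha
  have hs : Literature.ModelTheory.ExponentialFields.IsSemialgebraic ℚ
      (((bRep a a ha ha).constMul 2 isAlgebraic_two).domain ∩ {p | p 0 < (1:ℝ) / 2}) :=
    ((bRep a a ha ha).constMul 2 isAlgebraic_two).isSemialgebraic_domain.inter
      (Summit.KontsevichZagierPeriods.HermiteRigidity.CMTwistQuasiPeriodTransfer.isSemialgebraic_setOf_apply_lt_of_isAlgebraic
        hhalf 0)
  have hhd : (((bRep a a ha ha).constMul 2 isAlgebraic_two).restrict _ hs Set.inter_subset_left).domain
      = {x | 0 < x 0 ∧ x 0 < 1 / 2} := by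
    rw [KZ.IntegralRep.domain_restrict, show ((bRep a a ha ha).constMul 2 isAlgebraic_two).domain
      = (bRep a a ha ha).domain from rfl, hrd]
    ext x
    simp only [Set.mem_inter_iff, Set.mem_setOf_eq, Set.mem_Ioo]
    constructor
    · rintro ⟨⟨h0, _⟩, h2⟩; exact ⟨h0, h2⟩
    · rintro ⟨h0, h2⟩; exact ⟨⟨h0, by linarith⟩, h2⟩
  have hhi : Set.EqOn (((bRep a a ha ha).constMul 2 isAlgebraic_two).restrict _ hs Set.inter_subset_left).integrand
      (fun x => 2 * ((x 0) ^ ((a:ℝ) - 1) * (1 - x 0) ^ ((a:ℝ) - 1)))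
      (((bRep a a ha ha).constMul 2 isAlgebraic_two).restrict _ hs Set.inter_subset_left).domain := by
    intro x hx
    have hx' : x ∈ (bRep a a ha ha).domain := by
      rw [KZ.IntegralRep.domain_restrict] at hx
      exact hx.1
    rw [KZ.IntegralRep.integrand_restrict, KZ.IntegralRep.integrand_constMul]
    show 2 * (bRep a a ha ha).integrand x = _
    rw [hri hx']
  have hdd : ((bRep a (1/2) ha hb).constMul (dupConst a) (isAlgebraic_dupConst a)).domain
      = {x | x 0 ∈ Set.Ioo (0:ℝ) 1} := bRep_domain a (1/2) ha hb
  have hdi : Set.EqOn ((bRep a (1/2) ha hb).constMul (dupConst a) (isAlgebraic_dupConst a)).integrand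
      (fun x => (2:ℝ) ^ (1 - 2 * (a:ℝ)) * ((x 0) ^ ((a:ℝ) - 1) * (1 - x 0) ^ (-(1:ℝ) / 2)))
      ((bRep a (1/2) ha hb).constMul (dupConst a) (isAlgebraic_dupConst a)).domain := by
    intro x hx
    rw [KZ.IntegralRep.integrand_constMul]
    show dupConst a * (bRep a (1/2) ha hb).integrand x = _
    rw [bRep_integrand a (1/2) ha hb hx, dupConst]
    congr 3
    push_cast
    ring
  have e₁ := BetaMoves.betaSymm_fold a ha _ _ hrd hri hhd hhi
  have e₂ := BetaMoves.betaFold_duplication a ha _ _ hhd hhi hdd hdi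
  calc bcl a a = KZ.toFormalPeriod (KZ.of (bRep a a ha ha)) := bcl_eq ha ha
    _ = KZ.toFormalPeriod (KZ.of ((bRep a (1/2) ha hb).constMul (dupConst a) (isAlgebraic_dupConst a))) :=
        e₁.toFormalPeriod_eq.trans e₂.toFormalPeriod_eq
    _ = kc (dupConst a) (isAlgebraic_dupConst a) * KZ.toFormalPeriod (KZ.of (bRep a (1/2) ha hb)) :=
        toFormalPeriod_constMul _ _ _
    _ = kc (dupConst a) (isAlgebraic_dupConst a) * bcl a (1/2) := by rw [← bcl_eq ha hb]

/-- … and on values: `B(a,a) = 2^{1−2a}·B(a,½)`. (cite AndrewsAskeyRoy1999, Thm 1.5.1) -/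
theorem bval_dup (a : ℚ) (ha : 0 < a) : bval a a = dupConst a * bval a (1/2) := by
  have h := congrArg KZ.evalP (bcl_dup a ha)
  rw [map_mul, evalP_kc] at h; exact h

/-- Auxiliary step `isAlgebraic_sqrt_two`: is Algebraic sqrt two. [bookkeeping] -/
private theorem isAlgebraic_sqrt_two : IsAlgebraic ℚ (Real.sqrt 2) := by
  have h := KZ.isAlgebraic_natCast_rpow_ratCast 2 (1/2); convert h using 1; rw [Real.sqrt_eq_rpow]; push_cast; norm_num

/-- `κ(√2)`. [bookkeeping] -/
noncomputable def kcS : KZ.FormalPeriodRing := kc (Real.sqrt 2) isAlgebraic_sqrt_two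

/-- Auxiliary step `evalP_kcS`: eval P kc S. [bookkeeping] -/
@[simp] theorem evalP_kcS : KZ.evalP kcS = Real.sqrt 2 := evalP_kc _ _

/-- Auxiliary step `dupConst_quarter`: dup Const quarter. [bookkeeping] -/
theorem dupConst_quarter : dupConst (1/4) = Real.sqrt 2 := by
  rw [dupConst, Real.sqrt_eq_rpow]; push_cast; norm_num

/-- Auxiliary step `dupConst_threeQuarters`: dup Const three Quarters. [bookkeeping] -/
theorem dupConst_threeQuarters : dupConst (3/4) = (Real.sqrt 2)⁻¹ := by
  rw [dupConst, Real.sqrt_eq_rpow, ← Real.rpow_neg zero_le_two]; push_cast; norm_num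

/-- Legendre at `a = ¼`: `β(¼,¼) = κ(√2)·β(¼,½)`. (cite AndrewsAskeyRoy1999, Thm 1.5.1) -/
theorem bcl_quarter_quarter : bcl (1/4) (1/4) = kcS * bcl (1/4) (1/2) := by
  rw [bcl_dup (1/4) (by norm_num), kcS]
  congr 1; exact kc_congr _ _ dupConst_quarter

/-- Legendre at `a = ¾`: `β(¾,½) = κ(√2)·β(¾,¾)`. (cite AndrewsAskeyRoy1999, Thm 1.5.1) -/
theorem bcl_threeQuarters_half : bcl (3/4) (1/2) = kcS * bcl (3/4) (3/4) := by
  have h := bcl_dup (3/4) (by norm_num)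
  have hk : kcS * kc (dupConst (3/4)) (isAlgebraic_dupConst (3/4)) = 1 := by
    rw [kcS, ← kc_mul, ← kc_one]; refine kc_congr _ _ ?_; rw [dupConst_threeQuarters, mul_inv_cancel₀]; exact (Real.sqrt_pos.mpr two_pos).ne'
  rw [h, ← mul_assoc, hk, one_mul]

end Legendre

end Summit.KontsevichZagierPeriods.FermatIsogeny.DeepTargets
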